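import Summits.BirchSwinnertonDyer.BirchSwinnertonDyer.Theorems.ErratumRoadFiveShimuraKolyvaginOrderBoundInertLocalAll
import Literature.NumberTheory.EllipticCurves.MultiplicativeReductionJValuationProofs
import Literature.NumberTheory.EllipticCurves.NeronLocalHeightCompletion
import HarnessLib

/-!
# Route `ErratumRoadFive`, crux `EulerHalfNotRamNoInertSetAtFive` (item stmt-BirchSwinnertonDyer-19715),
# served-class road `ramified-twin-ram-transport`: the LOCAL LEAF OFF THE CARRIER — Kolyvagin's Selmer
# clause (d) at every place `v ∤ m·p`, keyed on `ord_ℓ j(E)` and blind to how `ℓ` decomposes in `K`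

Cell `bsd-stepL` (run/shared/lean/pub/bsd-stepL/), width seat `bsd-line-er5-p1-w3` (g32), HELPER for the crux
`Summit.BirchSwinnertonDyer.BirchSwinnertonDyer.Theses.ErratumRoadFive.EulerHalfNotRamNoInertSetAtFive`
(`--supports stmt-BirchSwinnertonDyer-19715 --as helper`; LEAD g7 memo rev 1.2 §8 TURNKEY, stub S3
`stub_genusKolyvaginLocal_RC` of the served-class item `EulerHalfPOnlyMultPotMultTwinAtFive`, SPEC bbb507f02f0120c2).
Sequel of shim-p1's `…ShimuraKolyvaginOrderBoundInertLocalAll.lean` (p469959; clause (d) on the 19718 profile).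

## What this file proves

The genus road (idea `ramified-twin-ram-transport`, bsd-idea-9 g14; LEAD assessment
`Cruxes/EulerHalfNotRamNoInertSetAtFive/…/LEAD-ASSESS-ramified-twin-g7.md`) runs Kolyvagin's argument for the
rank-one curve `E = W/ℚ` over an imaginary quadratic `K` that is RAMIFIED at an odd additive, potentially
multiplicative prime `q` of `E` (`ord_q j(E) = −m_q < 0`, `p ∤ m_q` — the served condition) and split at every
other bad prime. The abstract machine (`AbstractKolyvaginOrder.card_sha_primaryComponent_dvd_pow_index_of_points`,
leaf `GenusKolyvaginLocal` of bsd-addord's `Cruxes/MultLower/Lines/tame_roads_mult.lean`) wants, at every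
Kolyvagin level `m` and every finite place `v ∤ m`, the Selmer condition of the Kolyvagin class at `v`. The K2
END `kolyvaginClass_mem_selmerLocalKer_of_ringClassRational` dispatches on "`ℓ ∈ S` inert ∕ `ℓ ∉ S` split" and
cannot see a ramified `𝔮`. THIS FILE removes the decomposition profile from the mechanism:

* §1 `intCast_ordMinimalDiscriminant_baseChange_eq` — **`ord_w Δ_min(E/K) = −e(w|ℓ)·ord_ℓ j(E)`** at ANY
  multiplicative place `w` of `E/K` over `ℓ` (`K` any number field; Silverman VII.5.1 (b) over `𝓞_K` = the
  tree's `log_valuation_j_eq_ordMinimalDiscriminant_of_hasMultiplicativeReductionAt`, Mathlib's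
  `valuation_liesOver`, and `|x|_v = ℓ^{−ord_ℓ x}` on `ℚ`); hence `ord_ℓ j(E) < 0`
  (`padicValRat_j_neg_of_hasMultiplicativeReductionAt_baseChange`) and, for a prime `p > [K:ℚ]`,
  `p ∤ ord_ℓ j(E) ⇒ p ∤ ord_w Δ_min(E/K)` (`not_dvd_ordMinimalDiscriminant_baseChange_of_not_dvd_padicValRat_j`).
* §2 `kolyvaginClass_mem_selmerLocalKer_of_ringClassRational_of_ordMinimalDiscriminant` — the K2 mechanism
  (ring-class rationality ⇒ inertia at `v ∤ m` fixes the module; Kodaira–Néron exponent prime to `p ≥ 5`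
  into `E0Receptacle`; Milne I.3.8 at good `v`) for ANY elliptic `X/K` and ANY finite `v ∤ m`, under the one
  per-place hypothesis `X multiplicative at v ⇒ p ∤ ord_v Δ_min(X)` — no `S`, no `hsp`, no conductor.
* §3 `kolyvaginClass_mem_selmerLocalKer_of_ringClassRational_of_padicValRat_j` — for `X = E ⊗ K`, `E/ℚ`,
  `[K:ℚ] = 2 < 5 ≤ p`: the same under `E/K multiplicative at v ⇒ p ∤ ord_ℓ j(E)` for the prime `ℓ` under `v`
  (§1). At the RAMIFIED `𝔮` of the genus frame this is the served condition `p ∤ ord_q j(E)` read a second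
  time (`ord_𝔮 Δ_min(E/K) = 2m_q`; NO reduction-type computation at `𝔮`, no sign condition (ii)).
* §4 `kolyvaginClass_mem_selmerLocalKer_of_ringClassRational_ramifiedAt` — the frame END with a finite set
  `T` of untreated carrier primes: `q ∣ d_K` allowed, every prime of `N` outside `insert q T` split (`hsp`),
  the K2 ℚ-side clause `hTam` outside `insert q T`, `p ∤ ord_q j(E)`; conclusion at every `v ∤ m` over no
  prime of `T` (split bad `ℓ ≠ q`: A233 transport `not_dvd_ordMinimalDiscriminant_baseChange_of_split`).
* §5 `kolyvaginClass_mem_selmerLocalKer_offCarrier_of_pOnlyMult` — **the S1b-genus leaf**: with `p` the ONLY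
  multiplicative prime of `E` (the crux's S1b clause, SPEC binder `∀ ℓ, Mult W ℓ → ℓ = p`), `T = {p}`, `hTam` is
  vacuous: clause (d) at every `v ∤ m` with `p ∉ v`, from `hsp` off `q` and `p ∤ ord_q j(E)` ALONE — LEAD §8 S3
  «M on S1b»: the additive `ℓ ≠ q` have Kodaira–Néron exponent `≤ 4 < p`, `𝔮` has exponent `2m_q`.

## Honest framing

THEOREMS ONLY (no `def`, no named fact, no `sorry`; axioms standard). Nothing here constructs the genus CM
points, their trace ∕ congruence ∕ reflection relations, the sharp Jetchev count at the carrier `v ∣ p`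
(LEAD's S4), the Ш_an bookkeeping (S5) or the supply (S1): the served-class item is not filed yet and crux
19715 stays exactly as it is (closed modulo route items, blocked-on 19064@≥5). What this shows: the local
leaf S3 of the genus road is NOT the residual that bsd-addord declared for its own G5 («McCallum L4.3 at a
non-split multiplicative place with `p ∣ ord Δ`») — on the S1b class that place is the carrier `v ∣ p`,
excluded here and owned by S4; every other place costs nothing beyond `K[m]`-rationality and
`p ∤ ord_q j(E)`. BSD is not proved by any of this; no summit statement is touched; no census number moves.

## References

[cite: GrossLMS1991, §4 (4.1), Prop. 6.2 (1) (pp. 244–245)] [cite: McCallumLMS1991, §4 (4)–(5), Lemma 4.3]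
[cite: MilneADT2006, Ch. I Prop. 3.8] [cite: SilvermanAEC2009, Prop. VII.5.1 (b), Prop. VII.5.4 (a), Thm. VII.6.1]
[cite: NeukirchANT1999, Ch. I Prop. (8.2) (fundamental identity `Σ eᵢfᵢ = [K:ℚ]`)]
[cite: KohenPacetti2016, §1 (the ramified frame)] Cell files: HOME/line-er5-p1/lead/g7/LEAD-ASSESS-ramified-twin-g7.md
§8 (S3); HOME/line-er5-p1/w7/g9/SIGN-AND-FRAME-CHECK-w7g9.md §4 row #3; K2 file p469959 §§1–4.

presearch: «Selmer clause of Kolyvagin classes at a place ramified in K/ℚ, via ord_ℓ j» → [corpus: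
book:editornd-l-functions-arithmetic p.227 ff., Gross 1991 Prop. 6.2 (1)] (X₀(N), all ℓ ∣ N split — the
mechanism); [corpus: book:cornell1997-modular-forms-fermats-last-theorem pp.658–660] (local conditions at v ∣ N
under the Heegner hypothesis); [corpus: book:silverman2009 VII.5.1 (b)] (ord j = −ord Δ_min); Kohen–Pacetti
arXiv:1505.08059 §2.5 (ramified frame, rank statement only) — nothing keys the clause on `ord_ℓ j(E)` at a
ramified place: folklore assembly (lit search --hybrid ∕ lit vsearch k = 8 ∕ lit galaxy --star all «ramified in
K|Kolyvagin system|component group» 24 rows, 0 relevant; corpus + galaxy). `lean search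
'ordMinimalDiscriminant_baseChange|of_padicValRat_j'` → only the split transport (K2 §3) and IUT's semistable towers.
-/

noncomputable section

open scoped Classical AddSubgroup

set_option linter.dupNamespace false

namespace Summit.BirchSwinnertonDyer.BirchSwinnertonDyer.Theorems.RamifiedTwinGenusLocal

open WeierstrassCurve NumberField IsDedekindDomain Field
  Literature.NumberTheory.EllipticCurves Literature.NumberTheory.EllipticCurves.KolyvaginCocycle
  Literature.NumberTheory.EllipticCurves.RingClassField
  Literature.NumberTheory.GaloisRepresentations Literature.NumberTheory.NumberFields
  Literature.NumberTheory.DiophantineGeometry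
  Summit.BirchSwinnertonDyer.Rank1Residual.X11b
  Summit.BirchSwinnertonDyer.Rank1Residual.X11b.Three.GrossBadPlace
  Summit.BirchSwinnertonDyer.BirchSwinnertonDyer.Theorems

variable {K : Type} [Field K] [NumberField K]

/-! ### §1 `ord_w Δ_min(E/K) = −e(w|ℓ)·ord_ℓ j(E)` at a multiplicative place of a base change -/

/-- **`ord_w Δ_min(E/K) = −e(w|ℓ)·ord_ℓ j(E)` at a multiplicative place `w ∣ ℓ` of `E ⊗ K`.** `E = W/ℚ`
elliptic, `K` a number field, `w` a finite place of `K` containing the rational prime `ℓ`, `E/K` with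
multiplicative reduction at `w`. Silverman VII.5.1 (b) over `𝓞_K` (`ord_w j = −ord_w Δ_min`, tree
`log_valuation_j_eq_ordMinimalDiscriminant_of_hasMultiplicativeReductionAt`), `j(E ⊗ K) = j(E)`, and
`|x|_w = |x|_ℓ^{e(w|ℓ)}` on `ℚ` (Mathlib `valuation_liesOver`; `|x|_ℓ = ℓ^{−ord_ℓ x}`,
`Rat.HeightOneSpectrum.valuation_eq_exp_neg_padicValRat`). Valid at split, inert AND ramified `w`.
[cite: SilvermanAEC2009, Prop. VII.5.1 (b)] [cite: NeukirchANT1999, Ch. II (4.8) / Ch. I (8.2)] -/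
theorem intCast_ordMinimalDiscriminant_baseChange_eq (W : WeierstrassCurve ℚ) [W.IsElliptic]
    (w : HeightOneSpectrum (𝓞 K)) (hw : (W.baseChange K).HasMultiplicativeReductionAt w)
    {ℓ : ℕ} (hℓ : ℓ.Prime) (hℓw : (ℓ : 𝓞 K) ∈ w.asIdeal) :
    ((W.baseChange K).ordMinimalDiscriminant w : ℤ) =
      -((w.asIdeal.ramificationIdx ℤ : ℕ) : ℤ) * padicValRat ℓ W.j := by
  haveI : (W.baseChange K).IsElliptic := inferInstanceAs (W.map (algebraMap ℚ K)).IsElliptic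
  -- the place `v` of `ℤ` under `w`
  haveI := w.isMaximal
  haveI : (w.asIdeal.under ℤ).IsMaximal := Ideal.IsMaximal.under _ _
  have hv0 : w.asIdeal.under ℤ ≠ ⊥ := mt Ideal.eq_bot_of_comap_eq_bot w.ne_bot
  let v : HeightOneSpectrum ℤ := ⟨w.asIdeal.under ℤ, Ideal.IsMaximal.isPrime inferInstance, hv0⟩
  haveI : w.asIdeal.LiesOver v.asIdeal := ⟨rfl⟩
  haveI := v.isMaximal
  -- `ℓ` generates `v`
  have hℓv : ((ℓ : ℕ) : ℤ) ∈ v.asIdeal := by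
    change ((ℓ : ℕ) : ℤ) ∈ w.asIdeal.under ℤ
    rw [Ideal.under_def, Ideal.mem_comap, map_natCast]
    exact hℓw
  have hvℓ : v = (Rat.HeightOneSpectrum.primesEquiv (R := ℤ)).symm ⟨ℓ, hℓ⟩ :=
    (natCast_mem_asIdeal_iff_eq_primesEquiv_symm v hℓ).mp hℓv
  have hgen : Rat.HeightOneSpectrum.natGenerator v = ℓ := by
    have h1 : Rat.HeightOneSpectrum.primesEquiv (R := ℤ) v = ⟨ℓ, hℓ⟩ := by
      rw [hvℓ, Equiv.apply_symm_apply]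
    exact congrArg Subtype.val h1
  -- `j(E ⊗ K) = j(E) ≠ 0`
  have hjK : (W.baseChange K).j = algebraMap ℚ K W.j := W.map_j (algebraMap ℚ K)
  have hj0 : W.j ≠ 0 := by
    intro h0
    have h := (W.baseChange K).j_ne_zero_of_hasMultiplicativeReductionAt w hw
    rw [hjK, h0, map_zero] at h
    exact h rfl
  -- Silverman VII.5.1 (b) over `𝓞_K`, transported down to `ℚ`
  have hlog := (W.baseChange K).log_valuation_j_eq_ordMinimalDiscriminant_of_hasMultiplicativeReductionAt
    w hw
  have hlies := IsDedekindDomain.HeightOneSpectrum.valuation_liesOver (L := K) v w W.j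
  have he : v.asIdeal.ramificationIdx' w.asIdeal = w.asIdeal.ramificationIdx ℤ :=
    Ideal.ramificationIdx'_eq_ramificationIdx v.asIdeal w.asIdeal v.ne_bot
  have hval : v.valuation ℚ W.j = WithZero.exp (-padicValRat ℓ W.j) := by
    rw [Rat.HeightOneSpectrum.valuation_eq_exp_neg_padicValRat v hj0, hgen]
  rw [hjK, ← hlies, hval, ← WithZero.exp_nsmul, WithZero.log_exp, he, nsmul_eq_mul] at hlog
  rw [← hlog]
  ring

/-- **`ord_ℓ j(E) < 0` below a multiplicative place of `E ⊗ K`** (`ord_w Δ_min ≥ 1` at a node,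
`ordMinimalDiscriminant_ne_zero_of_hasMultiplicativeReductionAt`-style: `E/K` multiplicative at `w ∣ ℓ`
forces `E` potentially multiplicative at `ℓ`; in particular a potentially GOOD additive prime of `E` never
lies under a multiplicative place of any base change). [cite: SilvermanAEC2009, Prop. VII.5.1 (b), VII.5.4] -/
theorem padicValRat_j_neg_of_hasMultiplicativeReductionAt_baseChange (W : WeierstrassCurve ℚ)
    [W.IsElliptic] (w : HeightOneSpectrum (𝓞 K)) (hw : (W.baseChange K).HasMultiplicativeReductionAt w)
    {ℓ : ℕ} (hℓ : ℓ.Prime) (hℓw : (ℓ : 𝓞 K) ∈ w.asIdeal) :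
    padicValRat ℓ W.j < 0 := by
  haveI : (W.baseChange K).IsElliptic := inferInstanceAs (W.map (algebraMap ℚ K)).IsElliptic
  have h := intCast_ordMinimalDiscriminant_baseChange_eq W w hw hℓ hℓw
  have hpos : 0 < (W.baseChange K).ordMinimalDiscriminant w :=
    Nat.pos_of_ne_zero ((W.baseChange K).ordMinimalDiscriminant_ne_zero_of_hasMultiplicativeReductionAt w hw)
  have he0 : (0 : ℤ) ≤ ((w.asIdeal.ramificationIdx ℤ : ℕ) : ℤ) := by positivity
  by_contra hj
  rw [not_lt] at hj
  have : ((W.baseChange K).ordMinimalDiscriminant w : ℤ) ≤ 0 := by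
    rw [h]; nlinarith
  omega

/-- **`p ∤ ord_ℓ j(E) ⇒ p ∤ ord_w Δ_min(E/K)`** for a prime `p > [K:ℚ]` at a multiplicative place `w ∣ ℓ`
of `E ⊗ K`: `ord_w Δ_min(E/K) = −e(w|ℓ)·ord_ℓ j(E)` (§1) with `1 ≤ e(w|ℓ) ≤ [K:ℚ] < p` (fundamental
identity, Mathlib `Ideal.ramificationIdx_le_finrank`). The Kodaira–Néron input of Gross's Prop. 6.2 (1)
at a node, in ℚ-side currency and valid at a RAMIFIED place. [cite: SilvermanAEC2009, Prop. VII.5.1 (b), Thm. VII.6.1]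
[cite: NeukirchANT1999, Ch. I Prop. (8.2)] -/
theorem not_dvd_ordMinimalDiscriminant_baseChange_of_not_dvd_padicValRat_j (W : WeierstrassCurve ℚ)
    [W.IsElliptic] {p : ℕ} (hp : p.Prime) (hpK : Module.finrank ℚ K < p)
    (w : HeightOneSpectrum (𝓞 K)) (hw : (W.baseChange K).HasMultiplicativeReductionAt w)
    {ℓ : ℕ} (hℓ : ℓ.Prime) (hℓw : (ℓ : 𝓞 K) ∈ w.asIdeal) (hj : ¬ (p : ℤ) ∣ padicValRat ℓ W.j) :
    ¬ p ∣ (W.baseChange K).ordMinimalDiscriminant w := by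
  haveI : (W.baseChange K).IsElliptic := inferInstanceAs (W.map (algebraMap ℚ K)).IsElliptic
  have h := intCast_ordMinimalDiscriminant_baseChange_eq W w hw hℓ hℓw
  -- `e(w|ℓ) ≤ [K:ℚ] < p` and `e(w|ℓ) ≠ 0`
  haveI := w.isMaximal
  haveI : (w.asIdeal.under ℤ).IsMaximal := Ideal.IsMaximal.under _ _
  have hv0 : w.asIdeal.under ℤ ≠ ⊥ := mt Ideal.eq_bot_of_comap_eq_bot w.ne_bot
  let v : HeightOneSpectrum ℤ := ⟨w.asIdeal.under ℤ, Ideal.IsMaximal.isPrime inferInstance, hv0⟩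
  haveI : w.asIdeal.LiesOver v.asIdeal := ⟨rfl⟩
  haveI := v.isMaximal
  have he : v.asIdeal.ramificationIdx' w.asIdeal = w.asIdeal.ramificationIdx ℤ :=
    Ideal.ramificationIdx'_eq_ramificationIdx v.asIdeal w.asIdeal v.ne_bot
  have hle : w.asIdeal.ramificationIdx ℤ ≤ Module.finrank ℚ K := by
    rw [← he]; exact Ideal.ramificationIdx_le_finrank (𝓞 K) ℚ K w.asIdeal (p := v.asIdeal)
  have hne : w.asIdeal.ramificationIdx ℤ ≠ 0 := by
    rw [← he]; exact Ideal.IsDedekindDomain.ramificationIdx'_ne_zero_of_liesOver w.asIdeal v.ne_bot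
  intro hdvd
  have hpZ : Prime (p : ℤ) := Nat.prime_iff_prime_int.mp hp
  have h1 : (p : ℤ) ∣ ((w.asIdeal.ramificationIdx ℤ : ℕ) : ℤ) * padicValRat ℓ W.j := by
    have h2 : (p : ℤ) ∣ ((W.baseChange K).ordMinimalDiscriminant w : ℤ) := Int.natCast_dvd_natCast.mpr hdvd
    rw [h, neg_mul] at h2
    exact (dvd_neg.mp h2)
  rcases hpZ.dvd_or_dvd h1 with he' | hj'
  · have h3 : p ∣ w.asIdeal.ramificationIdx ℤ := Int.natCast_dvd_natCast.mp he'
    have h4 : p ≤ w.asIdeal.ramificationIdx ℤ := Nat.le_of_dvd (Nat.pos_of_ne_zero hne) h3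
    omega
  · exact hj hj'

/-! ### §2 The K2 mechanism, keyed on the place: clause (d) at `v ∤ m` from `X mult at v ⇒ p ∤ ord_v Δ_min` -/

/-- **The machine's Selmer clause at a place `v ∤ m`, for ANY elliptic `X/K`, from ring-class rationality
and ONE per-place Kodaira–Néron hypothesis.** `K` imaginary quadratic, `ι : K → ℂ`, `m ≥ 1`,
`K[m] = ringClassField K ι m` with a `K`-embedding `e : K[m] → K̄`; `X/K` elliptic; a prime `p ≥ 5`; an
admissible `A ≤ X(K̄)` for `p^M` all of whose points are rational over `e(K[m])` (printed `A = E(K[m])`,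
McCallum (5) ∕ Gross Lemma 4.3) and `P ∈ A` invariant modulo `p^M` (printed `P = P_m`, Gross (4.1)); a finite
place `v` with `m ∉ v` such that IF `X` is multiplicative at `v` THEN `p ∤ ord_v Δ_min(X)`. Conclusion:
`c(P) ∈ selmerLocalKer X K_v p^M`. Proof = the K2 END (p469959 §4) with its `S`-dispatch removed: inertia at
`v ∤ m` fixes `A` (`resGal_smul_eq_self_of_mem_inertia_of_ringClassRational`); good `v`: Milne I.3.8
(`kolyvaginClass_mem_selmerLocalKer_of_inertia_of_hasGoodReductionAt`); bad `v`: the Kodaira–Néron exponent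
(`ord_v Δ_min` at a node, `≤ 4` at a cusp) is prime to `p` (`exists_nsmul_mem_E0Receptacle_not_dvd_of_five_le`)
and kills inertia-fixed points into `E⁰` (`kolyvaginClass_mem_selmerLocalKer_of_inertiaFixed_of_nsmul_mem_E0Receptacle`).
NO hypothesis on the decomposition of the prime under `v` in `K`, none on a conductor.
[cite: GrossLMS1991, §4 (4.1), Prop. 6.2 (1)] [cite: McCallumLMS1991, Lemma 4.3, §4 (4)–(5)]
[cite: MilneADT2006, Ch. I Prop. 3.8] [cite: SilvermanAEC2009, Thm. VII.6.1] -/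
theorem kolyvaginClass_mem_selmerLocalKer_of_ringClassRational_of_ordMinimalDiscriminant
    (hK : IsImaginaryQuadratic K) (ι : K →+* ℂ) {m : ℕ} (hm : m ≠ 0)
    (e : ringClassField K ι m →ₐ[K] AlgebraicClosure K)
    (X : WeierstrassCurve K) [X.IsElliptic] {p : ℕ} (hp : p.Prime) (hp5 : 5 ≤ p)
    {M : ℕ} {hdiv : ∀ P : geomPoints X, ∃ Q, ((p ^ M : ℕ) : ℤ) • Q = P}
    {A : AddSubgroup (geomPoints X)}
    (hA : IsAdmissible (absoluteGaloisGroup K) A ((p ^ M : ℕ) : ℤ))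
    (hArat : ∀ a ∈ A, ∀ Φ : absoluteGaloisGroup K,
      (∀ x : ringClassField K ι m, Φ • e x = e x) → Φ • a = a)
    {P : geomPoints X} (hP : P ∈ invPoints (absoluteGaloisGroup K) A ((p ^ M : ℕ) : ℤ))
    (v : HeightOneSpectrum (𝓞 K)) (hv : ((m : ℕ) : 𝓞 K) ∉ v.asIdeal)
    (hmult : X.HasMultiplicativeReductionAt v → ¬ p ∣ X.ordMinimalDiscriminant v) :
    kolyvaginClass X ((p ^ M : ℕ) : ℤ) hdiv hA P hP ∈
      selmerLocalKer X (v.adicCompletion K) ((p ^ M : ℕ) : ℤ) := by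
  obtain ⟨𝔐, h𝔐⟩ := v.localPrimesAbove_nonempty
  have hAfix : ∀ σ ∈ 𝔐.inertia (absoluteGaloisGroup (v.adicCompletion K)), ∀ a ∈ A,
      resGal (K := K) (v.adicCompletion K) σ • a = a := fun σ hσ a ha ↦
    resGal_smul_eq_self_of_mem_inertia_of_ringClassRational hK ι hm e hv h𝔐 (hArat a ha) hσ
  by_cases hgood : X.HasGoodReductionAt v
  · -- good place: Milne I.3.8
    exact kolyvaginClass_mem_selmerLocalKer_of_inertia_of_hasGoodReductionAt X hA hP v hgood h𝔐
      (fun σ hσ ↦ hAfix σ hσ P hP.1)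
  · -- bad place: Kodaira–Néron exponent prime to `p`
    obtain ⟨c, hpc, hcE⟩ := exists_nsmul_mem_E0Receptacle_not_dvd_of_five_le X hp5 v hgood hmult h𝔐
    refine kolyvaginClass_mem_selmerLocalKer_of_inertiaFixed_of_nsmul_mem_E0Receptacle X hA hP v h𝔐
      hAfix ?_ hcE
    rw [Nat.isCoprime_iff_coprime]
    exact Nat.Coprime.pow_left M ((Nat.Prime.coprime_iff_not_dvd hp).mpr hpc)

/-! ### §3 Base changes from `ℚ`: clause (d) keyed on `ord_ℓ j(E)` -/

/-- **Clause (d) at `v ∤ m` for `E ⊗ K`, keyed on `ord_ℓ j(E)`.** `E = W/ℚ` elliptic, `K` imaginary quadratic,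
the module data as in §2, `p ≥ 5`, and a finite place `v ∤ m` such that, for the rational prime `ℓ` under `v`,
`E/K multiplicative at v ⇒ p ∤ ord_ℓ j(E)`. Then `c(P) ∈ selmerLocalKer (E ⊗ K) K_v p^M` (§2 + §1 with
`[K:ℚ] = 2 < p`). At a place `𝔮` over a prime `q` RAMIFIED in `K` at which `E` is additive and potentially
multiplicative (`ord_q j(E) = −m_q < 0`) the hypothesis reads `p ∤ m_q` — the served condition of the idea
`ramified-twin-ram-transport`, with no computation of the reduction type of `E/K` at `𝔮`.
[cite: GrossLMS1991, Prop. 6.2 (1)] [cite: SilvermanAEC2009, Prop. VII.5.1 (b), Thm. VII.6.1] -/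
theorem kolyvaginClass_mem_selmerLocalKer_of_ringClassRational_of_padicValRat_j
    (hK : IsImaginaryQuadratic K) (ι : K →+* ℂ) {m : ℕ} (hm : m ≠ 0)
    (e : ringClassField K ι m →ₐ[K] AlgebraicClosure K)
    (W : WeierstrassCurve ℚ) [W.IsElliptic] {p : ℕ} (hp : p.Prime) (hp5 : 5 ≤ p)
    {M : ℕ} {hdiv : ∀ P : geomPoints (W.baseChange K), ∃ Q, ((p ^ M : ℕ) : ℤ) • Q = P}
    {A : AddSubgroup (geomPoints (W.baseChange K))}
    (hA : IsAdmissible (absoluteGaloisGroup K) A ((p ^ M : ℕ) : ℤ))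
    (hArat : ∀ a ∈ A, ∀ Φ : absoluteGaloisGroup K,
      (∀ x : ringClassField K ι m, Φ • e x = e x) → Φ • a = a)
    {P : geomPoints (W.baseChange K)}
    (hP : P ∈ invPoints (absoluteGaloisGroup K) A ((p ^ M : ℕ) : ℤ))
    (v : HeightOneSpectrum (𝓞 K)) (hv : ((m : ℕ) : 𝓞 K) ∉ v.asIdeal)
    (hj : ∀ ℓ : ℕ, ℓ.Prime → (ℓ : 𝓞 K) ∈ v.asIdeal →
      (W.baseChange K).HasMultiplicativeReductionAt v → ¬ (p : ℤ) ∣ padicValRat ℓ W.j) :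
    kolyvaginClass (W.baseChange K) ((p ^ M : ℕ) : ℤ) hdiv hA P hP ∈
      selmerLocalKer (W.baseChange K) (v.adicCompletion K) ((p ^ M : ℕ) : ℤ) := by
  haveI : (W.baseChange K).IsElliptic := inferInstanceAs (W.map (algebraMap ℚ K)).IsElliptic
  refine kolyvaginClass_mem_selmerLocalKer_of_ringClassRational_of_ordMinimalDiscriminant hK ι hm e
    (W.baseChange K) hp hp5 hA hArat hP v hv fun hmw ↦ ?_
  -- the rational prime `ℓ` under `v`
  set u : HeightOneSpectrum (𝓞 ℚ) := v.under (𝓞 ℚ) with hudef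
  set ℓ : ℕ := (Rat.HeightOneSpectrum.primesEquiv u : ℕ) with hℓdef
  have hℓP : ℓ.Prime := (Rat.HeightOneSpectrum.primesEquiv u).2
  have hℓu : (ℓ : 𝓞 ℚ) ∈ u.asIdeal :=
    (natCast_mem_asIdeal_iff_eq_primesEquiv_symm u hℓP).mpr (Equiv.symm_apply_apply _ u).symm
  have hℓv : ((ℓ : ℕ) : 𝓞 K) ∈ v.asIdeal := by
    have h1 : (ℓ : 𝓞 ℚ) ∈ v.asIdeal.under (𝓞 ℚ) := hℓu
    rw [Ideal.under_def, Ideal.mem_comap, map_natCast] at h1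
    exact h1
  have h2 : Module.finrank ℚ K < p := by rw [hK.1]; omega
  exact not_dvd_ordMinimalDiscriminant_baseChange_of_not_dvd_padicValRat_j W hp h2 v hmw hℓP hℓv
    (hj ℓ hℓP hℓv hmw)

/-! ### §4 The ramified frame with a set `T` of untreated carrier primes -/

/-- **Clause (d) at every place `v ∤ m` off a carrier set `T`, in the RAMIFIED frame.** `E = W/ℚ` globally
minimal of conductor `N`, `K` imaginary quadratic, `p ≥ 5` prime, `q` a prime that MAY divide `d_K` (the
ramified prime of the genus frame), `T` a finite set of primes whose places are NOT treated (the carriers;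
on S1b `T = {p}`); hypotheses: `hsp` — every prime of `N` outside `insert q T` splits in `K` (frame (i) of
the idea card); `hTam` — the K2 ℚ-side clause at the multiplicative primes outside `insert q T`
(`p ∤ ord_ℓ Δ_min(E/ℚ)`); `hjq` — `p ∤ ord_q j(E)` (vacuous content if `E` is potentially good at `q`: then no
place over `q` is multiplicative, §1); the module data as in §2. Conclusion: clause (d) at every finite
`v ∤ m` containing no prime of `T`. Split `ℓ ≠ q`: shim-p1's A233 transport
`not_dvd_ordMinimalDiscriminant_baseChange_of_split` (`S := insert q T`); over `q`: §1 ∕ §3.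
[cite: GrossLMS1991, Prop. 6.2 (1), Lemma 4.3] [cite: McCallumLMS1991, Lemma 4.3]
[cite: SilvermanAEC2009, Prop. VII.5.1 (b), Prop. VII.5.4 (a), Thm. VII.6.1] [cite: KohenPacetti2016, §1] -/
theorem kolyvaginClass_mem_selmerLocalKer_of_ringClassRational_ramifiedAt
    (hK : IsImaginaryQuadratic K) (ι : K →+* ℂ) {m : ℕ} (hm : m ≠ 0)
    (e : ringClassField K ι m →ₐ[K] AlgebraicClosure K)
    (W : WeierstrassCurve ℚ) [W.IsElliptic] [W.IsGloballyMinimal] {N : ℕ} (hN : W.conductorNorm ℤ = N)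
    {p : ℕ} (hp : p.Prime) (hp5 : 5 ≤ p) {q : ℕ} (hq : q.Prime) {T : Finset ℕ}
    (hsp : ∀ ℓ : ℕ, ℓ.Prime → ℓ ∣ N → ℓ ∉ insert q T →
      ((Ideal.span {(ℓ : ℤ)}).primesOver (𝓞 K)).ncard = 2)
    (hTam : ∀ (ℓ : ℕ) [Fact ℓ.Prime], ℓ ∉ insert q T → W.HasMultiplicativeReductionAtPrime ℓ →
      ¬ p ∣ padicValInt ℓ W.minimalDiscriminantInt)
    (hjq : ¬ (p : ℤ) ∣ padicValRat q W.j)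
    {M : ℕ} {hdiv : ∀ P : geomPoints (W.baseChange K), ∃ Q, ((p ^ M : ℕ) : ℤ) • Q = P}
    {A : AddSubgroup (geomPoints (W.baseChange K))}
    (hA : IsAdmissible (absoluteGaloisGroup K) A ((p ^ M : ℕ) : ℤ))
    (hArat : ∀ a ∈ A, ∀ Φ : absoluteGaloisGroup K,
      (∀ x : ringClassField K ι m, Φ • e x = e x) → Φ • a = a)
    {P : geomPoints (W.baseChange K)}
    (hP : P ∈ invPoints (absoluteGaloisGroup K) A ((p ^ M : ℕ) : ℤ))
    (v : HeightOneSpectrum (𝓞 K)) (hv : ((m : ℕ) : 𝓞 K) ∉ v.asIdeal)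
    (hvT : ∀ t ∈ T, (t : 𝓞 K) ∉ v.asIdeal) :
    kolyvaginClass (W.baseChange K) ((p ^ M : ℕ) : ℤ) hdiv hA P hP ∈
      selmerLocalKer (W.baseChange K) (v.adicCompletion K) ((p ^ M : ℕ) : ℤ) := by
  haveI : (W.baseChange K).IsElliptic := inferInstanceAs (W.map (algebraMap ℚ K)).IsElliptic
  refine kolyvaginClass_mem_selmerLocalKer_of_ringClassRational_of_ordMinimalDiscriminant hK ι hm e
    (W.baseChange K) hp hp5 hA hArat hP v hv fun hmw ↦ ?_
  -- the rational prime `ℓ` under `v`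
  set u : HeightOneSpectrum (𝓞 ℚ) := v.under (𝓞 ℚ) with hudef
  set ℓ : ℕ := (Rat.HeightOneSpectrum.primesEquiv u : ℕ) with hℓdef
  have hℓP : ℓ.Prime := (Rat.HeightOneSpectrum.primesEquiv u).2
  have hℓu : (ℓ : 𝓞 ℚ) ∈ u.asIdeal :=
    (natCast_mem_asIdeal_iff_eq_primesEquiv_symm u hℓP).mpr (Equiv.symm_apply_apply _ u).symm
  have hℓv : ((ℓ : ℕ) : 𝓞 K) ∈ v.asIdeal := by
    have h1 : (ℓ : 𝓞 ℚ) ∈ v.asIdeal.under (𝓞 ℚ) := hℓu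
    rw [Ideal.under_def, Ideal.mem_comap, map_natCast] at h1
    exact h1
  by_cases hℓq : ℓ = q
  · -- over the (possibly ramified) prime `q`: the `j`-route
    have h2 : Module.finrank ℚ K < p := by rw [hK.1]; omega
    have hqv : ((q : ℕ) : 𝓞 K) ∈ v.asIdeal := hℓq ▸ hℓv
    exact not_dvd_ordMinimalDiscriminant_baseChange_of_not_dvd_padicValRat_j W hp h2 v hmw hq hqv hjq
  · -- over a split prime `ℓ ∉ insert q T`: the A233 transport of the K2 file
    have hℓT : ℓ ∉ T := fun ht ↦ hvT ℓ ht hℓv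
    have hℓS : ℓ ∉ insert q T := by
      rw [Finset.mem_insert]; rintro (h | h); exacts [hℓq h, hℓT h]
    exact not_dvd_ordMinimalDiscriminant_baseChange_of_split hK W hN hsp hTam v hmw hℓS

/-! ### §5 The S1b-genus leaf: `p` the only multiplicative prime, carrier `T = {p}` -/

/-- **LEAD §8 S3 on the S1b class: clause (d) at every place `v ∤ m·p` from `hsp` off `q` and
`p ∤ ord_q j(E)` alone.** `E = W/ℚ` globally minimal of conductor `N` whose ONLY multiplicative prime is `p`
(the crux's S1b clause `∀ ℓ, Mult W ℓ → ℓ = p`, SPEC `EulerHalfPOnlyMultPotMultTwinAtFive`), `p ≥ 5`, `q` a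
prime (the served additive potentially multiplicative prime, ramified in `K`) with `p ∤ ord_q j(E)`, `K`
imaginary quadratic with every prime `ℓ ∣ N`, `ℓ ≠ q` split (frame (i); `p` included or not), the module data
of the machine's `hpoints` binder at a Kolyvagin level `m` (`A` admissible for `p^M`, rational over `K[m]`;
`P ∈ A` invariant mod `p^M`). Then for EVERY finite place `v` of `K` with `m ∉ v` and `p ∉ v` the Kolyvagin
class of `P` lies in `selmerLocalKer (E ⊗ K) K_v p^M`. The carrier `v ∣ p` (split, `E` split multiplicative,
`p ∣ c_p`) is the business of the sharp Jetchev stub S4 and is excluded; every additive `ℓ ≠ q` is split with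
Kodaira–Néron exponent `≤ 4 < p`, and `𝔮` has exponent `ord_𝔮 Δ_min(E/K) = 2·(−ord_q j(E))` prime to `p`.
[cite: GrossLMS1991, Prop. 6.2 (1), Lemma 4.3] [cite: McCallumLMS1991, Lemma 4.3, §4 (4)–(5)]
[cite: MilneADT2006, Ch. I Prop. 3.8] [cite: SilvermanAEC2009, Prop. VII.5.1 (b), Thm. VII.6.1]
[cite: KohenPacetti2016, §1 (the ramified frame)] -/
theorem kolyvaginClass_mem_selmerLocalKer_offCarrier_of_pOnlyMult
    (hK : IsImaginaryQuadratic K) (ι : K →+* ℂ) {m : ℕ} (hm : m ≠ 0)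
    (e : ringClassField K ι m →ₐ[K] AlgebraicClosure K)
    (W : WeierstrassCurve ℚ) [W.IsElliptic] [W.IsGloballyMinimal] {N : ℕ} (hN : W.conductorNorm ℤ = N)
    {p : ℕ} (hp : p.Prime) (hp5 : 5 ≤ p) {q : ℕ} (hq : q.Prime)
    (hsp : ∀ ℓ : ℕ, ℓ.Prime → ℓ ∣ N → ℓ ≠ q → ((Ideal.span {(ℓ : ℤ)}).primesOver (𝓞 K)).ncard = 2)
    (honly : ∀ (ℓ : ℕ) [Fact ℓ.Prime], W.HasMultiplicativeReductionAtPrime ℓ → ℓ = p)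
    (hjq : ¬ (p : ℤ) ∣ padicValRat q W.j)
    {M : ℕ} {hdiv : ∀ P : geomPoints (W.baseChange K), ∃ Q, ((p ^ M : ℕ) : ℤ) • Q = P}
    {A : AddSubgroup (geomPoints (W.baseChange K))}
    (hA : IsAdmissible (absoluteGaloisGroup K) A ((p ^ M : ℕ) : ℤ))
    (hArat : ∀ a ∈ A, ∀ Φ : absoluteGaloisGroup K,
      (∀ x : ringClassField K ι m, Φ • e x = e x) → Φ • a = a)
    {P : geomPoints (W.baseChange K)}
    (hP : P ∈ invPoints (absoluteGaloisGroup K) A ((p ^ M : ℕ) : ℤ))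
    (v : HeightOneSpectrum (𝓞 K)) (hv : ((m : ℕ) : 𝓞 K) ∉ v.asIdeal) (hvp : ((p : ℕ) : 𝓞 K) ∉ v.asIdeal) :
    kolyvaginClass (W.baseChange K) ((p ^ M : ℕ) : ℤ) hdiv hA P hP ∈
      selmerLocalKer (W.baseChange K) (v.adicCompletion K) ((p ^ M : ℕ) : ℤ) := by
  refine kolyvaginClass_mem_selmerLocalKer_of_ringClassRational_ramifiedAt hK ι hm e W hN hp hp5 hq
    (T := {p}) (fun ℓ hℓ hℓN hℓS ↦ hsp ℓ hℓ hℓN ?_) (fun ℓ _ hℓS hmult ↦ ?_) hjq hA hArat hP v hv ?_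
  · rintro rfl; exact hℓS (Finset.mem_insert_self _ _)
  · exfalso
    have hℓp : ℓ = p := honly ℓ hmult
    exact hℓS (hℓp ▸ Finset.mem_insert_of_mem (Finset.mem_singleton_self _))
  · intro t ht
    rw [Finset.mem_singleton] at ht
    subst ht
    exact hvp

end Summit.BirchSwinnertonDyer.BirchSwinnertonDyer.Theorems.RamifiedTwinGenusLocal

end
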